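import Summits.QuantumFields.YangMills.Theorems.BalabanLadderNTMarkovMirrorBareTypical
import HarnessLib

/-!
# Crux `UVSeamRec` (stmt-QuantumFields-20043), stub `stub_floorsEngine` (S-B) / crux `NT` clause (i):
# the PINNED-AFFINE currency of the Markov–mirror line (method lane (M-aff) for the bare mirror floor)

Helper file (`--supports stmt-QuantumFields-20043`) of the seam stub-prover row `ym-20043-seam-s1` (owner RULING R87:
the (S-B) residual of record in Markov–mirror currency is {BL6, MF, clause (ii)}; the unpinned one-point data
{RBL+SUP, SF} with an EXISTENTIAL shell functional `𝒢` are clause (i) in mirror coordinates (finding (F),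
`…NTMarkovMirrorBare` / `…BareConverse`) and carry independent content only once `𝒢` is PINNED).  Sequel of the series
`BalabanLadderNTMarkovMirror*` (p505063 – p520967), general compact `G`, any lattice representation `r`.

This file types the simplest pin honestly — **`𝒢` affine in finitely many plaquette fields of the closed collar**,
`𝒢_g ζ = g₀ + ∑_{b ∈ S} g_b · plane_b ζ` (written out over the tree's `plane`; no definition is introduced) — and the
floor transfer of `…MarkovMirrorFloor` (p507216) in the MEASURE-TYPICAL currency the fleet lead's kit finding demands
(ym-spine-20043-p1 g7: no `∀`-exterior one-point law with depth-decaying tolerance survives self-dual uniform flux; the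
mirror argument only ever needs the remainder in `L²(μ_T)`, `mirrorForm_le_l2sq`):

* §1 `mirrorCov_ge_of_boundaryResponse_l2` — p507216 with (RBL) in mean square: a cube `Q` at times `≥ 1` fitting the
  torus with its closed collar, a bounded continuous cylinder `W` carried by `Q`, a bounded continuous cylinder `𝒢` on
  the closed collar, (RBL-L²) `∫ (kerE_Q^{lift U}(W) − p + 𝒢(lift U))² dμ_T(U) ≤ ε/4` and (SF) `4ε ≤ Cov_T(𝒢∘Θ₀, 𝒢)`
  give `9ε/4 ≤ Cov_T(W∘Θ₀, W)` (general `𝒢`);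
* §2 admissibility of the affine shell functional: `continuous_affinePlane`, `exists_abs_affinePlane_le`,
  `isCylinder_affinePlane`, `affinePlane_window` (plaquettes based in `[c − 1, c + b]` have their links in the closed
  collar `[c − 1, c + b + 1]`);
* §3 `torusE_const_add`, `torusCov_const_add`, **`shellCov_affine_eq_sum`**:
  `Cov_T(𝒢_g∘Θ₀, 𝒢_g) = ∑_{b, b' ∈ S} g_b g_{b'} Cov_T(plane_b∘Θ₀, plane_{b'})` — the shell floor of an affine pin is an
  explicit quadratic form in the MIRROR COVARIANCES OF COLLAR PLAQUETTE FIELDS on the torus (`torusCov_sum_sum`, p508701);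
* §4 `mirrorCov_ge_of_affineResponse` (sup form, feeding p507216) and `mirrorCov_ge_of_affineResponse_l2` (typical form,
  feeding §1): the hypothesis SHAPES
  (RBL-aff)  `|kerE_Q^ζ(W) − p + g₀ + ∑_b g_b plane_b ζ| ≤ √ε/2` for every exterior `ζ`, resp.
  (RBL-aff-L²) `∫ (kerE_Q^{lift U}(W) − p + g₀ + ∑_b g_b plane_b(lift U))² dμ_T ≤ ε/4`, and
  (SF-aff)   `4ε ≤ ∑_{b,b'} g_b g_{b'} Cov_T(plane_b∘Θ₀, plane_{b'})`
  give the bare mirror floor `9ε/4 ≤ Cov_T(W∘Θ₀, W)` (MF) — per coupling and torus.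

Located reading (no registry content).  (RBL-aff) is an exterior LINEAR-RESPONSE law for the cube's conditional mean of
the smeared density (card E's classical Dirichlet excess is a non-local QUADRATIC form in the boundary field strengths;
the affine-in-plaquettes pin is its diagonal/first-order shadow — unprinted for lattice Yang–Mills); (SF-aff) is a floor
on collar plaquette–plaquette connected two-point functions across the mirror.  Both are engine-grade inputs of crux `NT`
(barrier `PerturbativeInvisibility`: every finite order of lattice perturbation theory gives plaquette two-point functions
`O(g₀(a)⁴) → 0` at fixed physical separation); this file proves the implication only.  Nothing here is `SU(2)`-specific.
Refs: card E `Cruxes/NT/Ideas/markov-mirror-dirichlet-response.md` (Mechanism 1–5, «What it needs» RBL/SF);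
Osterwalder–Seiler 1978 §2; Glimm–Jaffe 1987 §6.1.
-/

set_option autoImplicit false

noncomputable section

open MeasureTheory Filter Topology
open Literature.MathematicalPhysics.QuantumFieldTheory Literature.MathematicalPhysics.QuantumLattice
open Literature.Probability.LatticeModels
open Summit.QuantumFields.YangMills.Cruxes.OSLegsFromFemtoAndGap.DlrCollarTransfer
open Summit.QuantumFields.YangMills.Cruxes.NT.Reference (continuous_kerE continuous_kerE_torusLift)
open Summit.QuantumFields.YangMills.Cruxes.NT.BoundaryLaw (abs_kerE_le)
open Summit.QuantumFields.YangMills.Cruxes.NT.Reflection (sq_cov_negReflect_le_odd_pos integrable_wilson_of_bdd)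
open Summit.QuantumFields.YangMills.Cruxes.OSLegsAtWeakCouplingC.InheritedAmplitudeGates.StubInherit
  (integrable_lift)

namespace Summit.QuantumFields.YangMills.Cruxes.NT.MarkovMirror

/-! ## §1 The mirror floor transfer with (RBL) in mean square -/

section FloorL2

variable (G : Type) [Group G] [TopologicalSpace G] [IsTopologicalGroup G] [CompactSpace G]
  [MeasurableSpace G] [BorelSpace G] (r : LatticeRep G)

/-- **Mirror floor transfer, measure-typical form (fixed `β ≥ 0`, torus `2L+1`).**  A cube `Q = (c, b)` at times
`≥ 1` with its closed collar inside the window (`c 0 + b + 3 ≤ L`, `−L + 2 ≤ c j`, `c j + b + 2 ≤ L + 1`); `W` a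
bounded continuous cylinder observable with links based in `[c, c + b]`; `𝒢` a bounded continuous cylinder functional
with links based in `[c − 1, c + b + 1]`; a reference value `p` and `ε > 0` with
(RBL-L²) `∫ (kerE_Q^{lift U}(W) − p + 𝒢(lift U))² dμ_T(U) ≤ ε/4` (mean square under Wilson's torus measure) and
(SF) `4ε ≤ Cov_T(𝒢∘Θ₀, 𝒢)`.  Then `9ε/4 ≤ Cov_T(W∘Θ₀, W)`.  Same three lines as `mirrorCov_ge_of_boundaryResponse`
(mirror factorisation, expansion along `m = D − 𝒢̃ + p`, reflection-positivity Cauchy–Schwarz), with the diagonal entry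
of the remainder bounded by its mean square (`mirrorForm_le_l2sq`) instead of its sup. [folklore] -/
theorem mirrorCov_ge_of_boundaryResponse_l2 {β : ℝ} (hβ : 0 ≤ β) (c : Fin 4 → ℤ) (b L : ℕ) (hc0 : 1 ≤ c 0)
    (hcL : c 0 + (b : ℤ) + 3 ≤ L) (hc : ∀ j, -(L : ℤ) + 2 ≤ c j ∧ c j + (b : ℤ) + 2 ≤ (L : ℤ) + 1)
    {W : LGConfig 4 G → ℝ} (hWc : Continuous W) {MW : ℝ} (hMW : ∀ U, |W U| ≤ MW)
    {SW : Finset (Literature.MathematicalPhysics.QuantumLattice.ZdEdge 4)} (hWS : IsCylinder W SW)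
    (hSW : ∀ e ∈ SW, ∀ j, c j ≤ e.1 j ∧ e.1 j ≤ c j + b)
    {𝒢 : LGConfig 4 G → ℝ} (h𝒢c : Continuous 𝒢) {M𝒢 : ℝ} (hM𝒢 : ∀ U, |𝒢 U| ≤ M𝒢)
    {S𝒢 : Finset (Literature.MathematicalPhysics.QuantumLattice.ZdEdge 4)} (h𝒢S : IsCylinder 𝒢 S𝒢)
    (hS𝒢 : ∀ e ∈ S𝒢, ∀ j, c j - 1 ≤ e.1 j ∧ e.1 j ≤ c j + b + 1)
    {p ε : ℝ} (hε : 0 < ε)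
    (hd2 : torusE G r β L (fun V => (kerE G r β c b V W - p + 𝒢 V) ^ 2) ≤ ε / 4)
    (hSF : 4 * ε ≤ torusE G r β L (fun V => 𝒢 (cfgReflect V) * 𝒢 V) -
      torusE G r β L (fun V => 𝒢 (cfgReflect V)) * torusE G r β L 𝒢) :
    9 * ε / 4 ≤ torusE G r β L (fun V => W (cfgReflect V) * W V) -
      torusE G r β L (fun V => W (cfgReflect V)) * torusE G r β L W := by
  classical
  haveI := r.secondCountableTopology
  haveI := isProbabilityMeasure_wilsonMeasure (d := 4) (L := 2 * L + 1) r.ρ r.continuous β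
  -- the three torus observables: boundary response `m`, shell `Gt`, remainder `D`
  set m : GaugeConfig 4 (2 * L + 1) G → ℝ := fun U => kerE G r β c b (torusLift (2 * L + 1) U) W with hm
  set Gt : GaugeConfig 4 (2 * L + 1) G → ℝ := fun U => 𝒢 (torusLift (2 * L + 1) U) with hGt
  set D : GaugeConfig 4 (2 * L + 1) G → ℝ := fun U => m U - p + Gt U with hD
  -- regularity
  have hmc : Continuous m := continuous_kerE_torusLift G r β c b (2 * L + 1) hWc hMW
  have hmb : ∀ U, |m U| ≤ MW := fun U => abs_kerE_le G r β c b _ hMW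
  have hGtc : Continuous Gt := h𝒢c.comp (continuous_torusLift _)
  have hGtb : ∀ U, |Gt U| ≤ M𝒢 := fun U => hM𝒢 _
  have hDc : Continuous D := (hmc.sub continuous_const).add hGtc
  have hDb : ∀ U, |D U| ≤ MW + |p| + M𝒢 := fun U => by
    simp only [hD]
    calc |m U - p + Gt U| ≤ |m U - p| + |Gt U| := abs_add_le _ _
      _ ≤ |m U| + |p| + |Gt U| := by linarith [abs_sub (m U) p]
      _ ≤ MW + |p| + M𝒢 := by linarith [hmb U, hGtb U]
  -- non-negative-half dependence of `Gt` and `D` (for reflection positivity)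
  have hposG : DependsOn Gt {e : Edge 4 (2 * L + 1) | (e.1 0).val ≤ L ∧ ((e.1.shift e.2) 0).val ≤ L} :=
    dependsOn_posHalf_of_window L h𝒢S fun e he => ⟨by linarith [(hS𝒢 e he 0).1], by linarith [(hS𝒢 e he 0).2]⟩
  have hposm : DependsOn m {e : Edge 4 (2 * L + 1) | (e.1 0).val ≤ L ∧ ((e.1.shift e.2) 0).val ≤ L} :=
    dependsOn_posHalf_of_window L (isCylinder_kerE G r β c b hWc.measurable hWS) fun e he => by
      have := kerE_supp_window hSW he 0
      constructor <;> linarith [this.1, this.2]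
  have hposD : DependsOn D {e : Edge 4 (2 * L + 1) | (e.1 0).val ≤ L ∧ ((e.1.shift e.2) 0).val ≤ L} :=
    fun U V hUV => by simp only [hD, hposm hUV, hposG hUV]
  have hL1 : 1 ≤ L := by linarith
  -- (3) reflection-positivity Cauchy–Schwarz for the pair `(Gt, D)`
  have hcs := sq_cov_negReflect_le_odd_pos (d := 4) (L := 2 * L + 1) r.ρ rfl hL1 r.continuous hβ
    hGtc.measurable hDc.measurable ⟨M𝒢, hGtb⟩ ⟨MW + |p| + M𝒢, hDb⟩ hposG hposD
  -- (2) expansion of `B(m, m)` along `m = D − Gt + p`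
  have hexp := mirrorForm_expand (T := 2 * L + 1) r.ρ r.continuous β hDc.measurable hGtc.measurable hDb hGtb p
  have em : ∀ U, m U = D U - Gt U + p := fun U => by simp only [hD]; ring
  -- (4) the remainder's diagonal entry is below its MEAN SQUARE, which is small
  have hdd := mirrorForm_le_l2sq (T := 2 * L + 1) r.ρ r.continuous β hDc.measurable hDb
  have hd2' : ∫ U, D U ^ 2 ∂(wilsonMeasure (d := 4) (L := 2 * L + 1) r.ρ β) ≤ ε / 4 := by
    unfold torusE at hd2
    exact hd2
  have hdd' : (∫ U, D U.negReflect * D U ∂(wilsonMeasure (d := 4) (L := 2 * L + 1) r.ρ β)) -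
      (∫ U, D U ∂(wilsonMeasure (d := 4) (L := 2 * L + 1) r.ρ β)) ^ 2 ≤ ε / 4 := hdd.trans hd2'
  -- (1) the mirror factorisation, in `ϑ`-coordinates
  have hfac := torusCov_reflect_lift_eq_torusCov_reflect_kerE G r β c b L hc0 hcL hc hWc hWc hMW hMW hWS hWS hSW hSW
  have hinvm : ∫ U, m U.negReflect ∂(wilsonMeasure (d := 4) (L := 2 * L + 1) r.ρ β) =
      ∫ U, m U ∂(wilsonMeasure (d := 4) (L := 2 * L + 1) r.ρ β) :=
    integral_comp_negReflect_eq (d := 4) (L := 2 * L + 1) r.ρ r.continuous β m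
  have hinvG : ∫ U, Gt U.negReflect ∂(wilsonMeasure (d := 4) (L := 2 * L + 1) r.ρ β) =
      ∫ U, Gt U ∂(wilsonMeasure (d := 4) (L := 2 * L + 1) r.ρ β) :=
    integral_comp_negReflect_eq (d := 4) (L := 2 * L + 1) r.ρ r.continuous β Gt
  -- assemble
  unfold torusE at hfac hSF ⊢
  simp only [← torusLift_negReflect] at hfac hSF ⊢
  rw [hfac]
  change 9 * ε / 4 ≤ (∫ U, m U.negReflect * m U ∂(wilsonMeasure (d := 4) (L := 2 * L + 1) r.ρ β)) -
    (∫ U, m U.negReflect ∂(wilsonMeasure (d := 4) (L := 2 * L + 1) r.ρ β)) *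
      (∫ U, m U ∂(wilsonMeasure (d := 4) (L := 2 * L + 1) r.ρ β))
  change 4 * ε ≤ (∫ U, Gt U.negReflect * Gt U ∂(wilsonMeasure (d := 4) (L := 2 * L + 1) r.ρ β)) -
    (∫ U, Gt U.negReflect ∂(wilsonMeasure (d := 4) (L := 2 * L + 1) r.ρ β)) *
      (∫ U, Gt U ∂(wilsonMeasure (d := 4) (L := 2 * L + 1) r.ρ β)) at hSF
  rw [hinvm]
  rw [hinvG] at hSF
  have hmm : (∫ U, m U.negReflect * m U ∂(wilsonMeasure (d := 4) (L := 2 * L + 1) r.ρ β)) -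
      (∫ U, m U ∂(wilsonMeasure (d := 4) (L := 2 * L + 1) r.ρ β)) *
        (∫ U, m U ∂(wilsonMeasure (d := 4) (L := 2 * L + 1) r.ρ β)) =
      (∫ U, (D U.negReflect - Gt U.negReflect + p) * (D U - Gt U + p) ∂(wilsonMeasure (d := 4) (L := 2 * L + 1) r.ρ β)) -
        (∫ U, (D U - Gt U + p) ∂(wilsonMeasure (d := 4) (L := 2 * L + 1) r.ρ β)) ^ 2 := by
    simp only [← em, sq]
  rw [hmm, hexp]
  exact mirror_floor_arith rfl hcs (by nlinarith [hSF]) hdd' hε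

/-- **Sup ⇒ mean square.**  A uniform bound `|Φ| ≤ δ` on a continuous `Φ` gives `E_T[Φ²∘lift] ≤ δ²` on every torus:
the (RBL+SUP) form of p507216 implies the (RBL-L²) form of `mirrorCov_ge_of_boundaryResponse_l2` (with `δ = √ε/2`,
`δ² = ε/4`). [folklore] -/
theorem torusE_sq_le_of_abs_le (β : ℝ) (L : ℕ) {Φ : LGConfig 4 G → ℝ} (hΦc : Continuous Φ) {δ : ℝ}
    (hΦ : ∀ U, |Φ U| ≤ δ) : torusE G r β L (fun V => Φ V ^ 2) ≤ δ ^ 2 := by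
  haveI := r.secondCountableTopology
  haveI := isProbabilityMeasure_wilsonMeasure (d := 4) (L := 2 * L + 1) r.ρ r.continuous β
  have hle : ∀ U : GaugeConfig 4 (2 * L + 1) G, Φ (torusLift (2 * L + 1) U) ^ 2 ≤ δ ^ 2 := fun U => by
    rw [← sq_abs]; exact pow_le_pow_left₀ (abs_nonneg _) (hΦ _) 2
  have iΦ2 : Integrable (fun U : GaugeConfig 4 (2 * L + 1) G => Φ (torusLift (2 * L + 1) U) ^ 2)
      (wilsonMeasure (d := 4) (L := 2 * L + 1) r.ρ β) := by
    have h := integrable_lift (T := 2 * L + 1) G r β (hΦc.pow 2)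
    exact h
  have hmono := integral_mono iΦ2 (integrable_const (δ ^ 2)) fun U => hle U
  rw [integral_const, smul_eq_mul, probReal_univ, one_mul] at hmono
  unfold torusE
  exact hmono

end FloorL2

/-! ## §2 The affine shell functional `ζ ↦ g₀ + ∑_{b ∈ S} g_b · plane_b ζ`: admissibility -/

section Affine

variable (G : Type) [Group G] [TopologicalSpace G] [IsTopologicalGroup G] [CompactSpace G]
  [MeasurableSpace G] [BorelSpace G] (r : LatticeRep G)

omit [CompactSpace G] [BorelSpace G] in
/-- **Continuity** of the affine shell functional over a finite plaquette family `S` (pairs orientation × base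
site), coefficients `g`, constant `g₀`. [folklore] -/
theorem continuous_affinePlane (S : Finset ((Fin 4 × Fin 4) × (Fin 4 → ℤ))) (g₀ : ℝ)
    (g : (Fin 4 × Fin 4) × (Fin 4 → ℤ) → ℝ) :
    Continuous fun ζ : LGConfig 4 G => g₀ + ∑ pl ∈ S, g pl * plane G r pl.1 pl.2 ζ :=
  continuous_const.add (continuous_finsetSum _ fun _ _ => continuous_const.mul (continuous_plane r _ _))

omit [BorelSpace G] in
/-- **Bound** `|g₀ + ∑ g_b plane_b| ≤ |g₀| + (∑ |g_b|)·C_plane`. [folklore] -/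
theorem exists_abs_affinePlane_le (S : Finset ((Fin 4 × Fin 4) × (Fin 4 → ℤ))) (g₀ : ℝ)
    (g : (Fin 4 × Fin 4) × (Fin 4 → ℤ) → ℝ) :
    ∃ M : ℝ, ∀ ζ : LGConfig 4 G, |g₀ + ∑ pl ∈ S, g pl * plane G r pl.1 pl.2 ζ| ≤ M := by
  obtain ⟨C, hC⟩ := exists_abs_plane_le (G := G) r
  refine ⟨|g₀| + ∑ pl ∈ S, |g pl| * C, fun ζ => ?_⟩
  calc |g₀ + ∑ pl ∈ S, g pl * plane G r pl.1 pl.2 ζ|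
      ≤ |g₀| + |∑ pl ∈ S, g pl * plane G r pl.1 pl.2 ζ| := abs_add_le _ _
    _ ≤ |g₀| + ∑ pl ∈ S, |g pl * plane G r pl.1 pl.2 ζ| := by
        gcongr; exact Finset.abs_sum_le_sum_abs _ _
    _ ≤ |g₀| + ∑ pl ∈ S, |g pl| * C := by
        gcongr
        rw [abs_mul]
        exact mul_le_mul_of_nonneg_left (hC _ _ _) (abs_nonneg _)

omit [IsTopologicalGroup G] [CompactSpace G] [BorelSpace G] in
/-- **Quasilocality**: the affine shell functional is a cylinder observable on the union of the plaquette supports.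
[folklore] -/
theorem isCylinder_affinePlane (S : Finset ((Fin 4 × Fin 4) × (Fin 4 → ℤ))) (g₀ : ℝ)
    (g : (Fin 4 × Fin 4) × (Fin 4 → ℤ) → ℝ) :
    IsCylinder (fun ζ : LGConfig 4 G => g₀ + ∑ pl ∈ S, g pl * plane G r pl.1 pl.2 ζ)
      (S.biUnion fun pl => (originPlaquetteSupport pl.1.1 pl.1.2).image fun e => (e.1 - -pl.2, e.2)) := by
  intro U V h
  exact congrArg (fun t : ℝ => g₀ + t)
    (isCylinder_sum G S g (fun pl => plane G r pl.1 pl.2) _ (fun pl _ => isCylinder_plane r pl.1 pl.2) h)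

/-- **Window**: if every plaquette of the family is based in `[c − 1, c + b]` (coordinatewise), the links of the
affine shell functional are based in the closed collar window `[c − 1, c + b + 1]` of the cube `(c, b)` — the side
condition of `mirrorCov_ge_of_boundaryResponse[_l2]` (`near_of_mem_supp_plane`: a plaquette based at `x` has its links
based at sites `y` with `0 ≤ y − x ≤ 1`). [folklore] -/
theorem affinePlane_window {c : Fin 4 → ℤ} {b : ℕ} {S : Finset ((Fin 4 × Fin 4) × (Fin 4 → ℤ))}
    (hS : ∀ pl ∈ S, ∀ j : Fin 4, c j - 1 ≤ pl.2 j ∧ pl.2 j ≤ c j + b) :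
    ∀ e ∈ S.biUnion (fun pl => (originPlaquetteSupport pl.1.1 pl.1.2).image fun e => (e.1 - -pl.2, e.2)),
      ∀ j : Fin 4, c j - 1 ≤ e.1 j ∧ e.1 j ≤ c j + b + 1 := by
  intro e he j
  obtain ⟨pl, hpl, he'⟩ := Finset.mem_biUnion.1 he
  have h01 := near_of_mem_supp_plane he' j
  have hw := hS pl hpl j
  constructor <;> linarith [h01.1, h01.2, hw.1, hw.2]

end Affine

/-! ## §3 The shell covariance of an affine pin is a quadratic form in collar plaquette mirror covariances -/

section ShellCov

variable (G : Type) [Group G] [TopologicalSpace G] [IsTopologicalGroup G] [CompactSpace G]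
  [MeasurableSpace G] [BorelSpace G] (r : LatticeRep G)

/-- Torus expectation of a constant plus a continuous observable. [folklore] -/
theorem torusE_const_add (β : ℝ) (L : ℕ) (p : ℝ) {A : LGConfig 4 G → ℝ} (hA : Continuous A) :
    torusE G r β L (fun V => p + A V) = p + torusE G r β L A := by
  haveI := r.secondCountableTopology
  haveI := isProbabilityMeasure_wilsonMeasure (d := 4) (L := 2 * L + 1) r.ρ r.continuous β
  unfold torusE
  rw [integral_add (integrable_const p) (integrable_lift G r β hA), integral_const, smul_eq_mul, probReal_univ,
    one_mul]

/-- Torus expectation of a sum of two continuous observables. [folklore] -/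
theorem torusE_add (β : ℝ) (L : ℕ) {A B : LGConfig 4 G → ℝ} (hA : Continuous A) (hB : Continuous B) :
    torusE G r β L (fun V => A V + B V) = torusE G r β L A + torusE G r β L B := by
  unfold torusE
  exact integral_add (integrable_lift G r β hA) (integrable_lift G r β hB)

/-- Torus expectation of a scalar multiple. [folklore] -/
theorem torusE_const_mul (β : ℝ) (L : ℕ) (k : ℝ) (A : LGConfig 4 G → ℝ) :
    torusE G r β L (fun V => k * A V) = k * torusE G r β L A := by
  unfold torusE
  exact integral_const_mul k _

/-- **Affine recentring (additive form).**  For continuous observables `A` (read on the reflected field in the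
application) and `B` and constants `p, q`: `Cov_T(p + A, q + B) = Cov_T(A, B)`. [folklore] -/
theorem torusCov_const_add (β : ℝ) (L : ℕ) {A B : LGConfig 4 G → ℝ} (hA : Continuous A) (hB : Continuous B)
    (p q : ℝ) :
    torusE G r β L (fun V => (p + A V) * (q + B V)) -
        torusE G r β L (fun V => p + A V) * torusE G r β L (fun V => q + B V) =
      torusE G r β L (fun V => A V * B V) - torusE G r β L A * torusE G r β L B := by
  have e1 : (fun V : LGConfig 4 G => (p + A V) * (q + B V)) =
      fun V => p * q + ((p * B V + q * A V) + A V * B V) := by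
    funext V; ring
  have h1 : Continuous fun V => p * B V := by fun_prop
  have h2 : Continuous fun V => q * A V := by fun_prop
  have h12 : Continuous fun V => p * B V + q * A V := by fun_prop
  have hAB : Continuous fun V => A V * B V := by fun_prop
  have h3 : Continuous fun V => (p * B V + q * A V) + A V * B V := by fun_prop
  rw [e1, torusE_const_add G r β L (p * q) h3, torusE_add G r β L h12 hAB, torusE_add G r β L h1 h2,
    torusE_const_mul G r β L p B, torusE_const_mul G r β L q A, torusE_const_add G r β L p hA,
    torusE_const_add G r β L q hB]
  ring

/-- **Shell covariance of an affine pin.**  For a finite plaquette family `S`, coefficients `g` and a constant `g₀`,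
on the torus of side `2L+1` (read through the periodic lift, `Θ₀ = cfgReflect`):
`Cov_T(𝒢_g∘Θ₀, 𝒢_g) = ∑_{b ∈ S} ∑_{b' ∈ S} g_b g_{b'} · Cov_T(plane_b∘Θ₀, plane_{b'})`,
`𝒢_g = g₀ + ∑_b g_b plane_b` — the (SF) floor of an AFFINE shell functional is a quadratic form in the mirror
covariances of the collar plaquette fields (p508701 `torusCov_sum_sum` after dropping the constant). [folklore] -/
theorem shellCov_affine_eq_sum (β : ℝ) (L : ℕ) (S : Finset ((Fin 4 × Fin 4) × (Fin 4 → ℤ))) (g₀ : ℝ)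
    (g : (Fin 4 × Fin 4) × (Fin 4 → ℤ) → ℝ) :
    torusE G r β L (fun V => (g₀ + ∑ pl ∈ S, g pl * plane G r pl.1 pl.2 (cfgReflect V)) *
          (g₀ + ∑ pl ∈ S, g pl * plane G r pl.1 pl.2 V)) -
        torusE G r β L (fun V => g₀ + ∑ pl ∈ S, g pl * plane G r pl.1 pl.2 (cfgReflect V)) *
          torusE G r β L (fun V => g₀ + ∑ pl ∈ S, g pl * plane G r pl.1 pl.2 V) =
      ∑ pl ∈ S, ∑ pl' ∈ S, g pl * g pl' *
        (torusE G r β L (fun V => plane G r pl.1 pl.2 (cfgReflect V) * plane G r pl'.1 pl'.2 V) -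
          torusE G r β L (fun V => plane G r pl.1 pl.2 (cfgReflect V)) * torusE G r β L (plane G r pl'.1 pl'.2)) := by
  have hA : Continuous fun V : LGConfig 4 G => ∑ pl ∈ S, g pl * plane G r pl.1 pl.2 (cfgReflect V) :=
    continuous_finsetSum _ fun pl _ => continuous_const.mul ((continuous_plane r _ _).comp continuous_cfgReflect)
  have hB : Continuous fun V : LGConfig 4 G => ∑ pl ∈ S, g pl * plane G r pl.1 pl.2 V :=
    continuous_finsetSum _ fun pl _ => continuous_const.mul (continuous_plane r _ _)
  rw [torusCov_const_add G r β L hA hB g₀ g₀]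
  exact torusCov_sum_sum G r β L S S g g (fun pl V => plane G r pl.1 pl.2 (cfgReflect V))
    (fun pl => plane G r pl.1 pl.2) (fun pl _ => (continuous_plane r _ _).comp continuous_cfgReflect)
    (fun pl _ => continuous_plane r _ _)

end ShellCov

/-! ## §4 (RBL-aff) ∧ (SF-aff) ⇒ the bare mirror floor (MF), per coupling and torus -/

section AffineFloor

variable (G : Type) [Group G] [TopologicalSpace G] [IsTopologicalGroup G] [CompactSpace G]
  [MeasurableSpace G] [BorelSpace G] (r : LatticeRep G)

/-- **The bare mirror floor from an affine response law, sup form (fixed `β ≥ 0`, torus `2L+1`).**  A cube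
`Q = (c, b)` at times `≥ 1` with its closed collar inside the window; `W` a bounded continuous cylinder with links in
`[c, c + b]`; a finite plaquette family `S` based in `[c − 1, c + b]`, coefficients `g`, constants `g₀, p`, `ε > 0`;
(RBL-aff) `|kerE_Q^ζ(W) − p + (g₀ + ∑_b g_b plane_b ζ)| ≤ √ε/2` for EVERY exterior `ζ`;
(SF-aff)  `4ε ≤ ∑_{b,b'} g_b g_{b'} Cov_T(plane_b∘Θ₀, plane_{b'})`.
Then `9ε/4 ≤ Cov_T(W∘Θ₀, W)` — `mirrorCov_ge_of_boundaryResponse` (p507216) at the affine pin, (SF) rewritten by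
`shellCov_affine_eq_sum`.  (The sup form is recorded for completeness; the typical form below is the one a supplier
should target.) [folklore] -/
theorem mirrorCov_ge_of_affineResponse {β : ℝ} (hβ : 0 ≤ β) (c : Fin 4 → ℤ) (b L : ℕ) (hc0 : 1 ≤ c 0)
    (hcL : c 0 + (b : ℤ) + 3 ≤ L) (hc : ∀ j, -(L : ℤ) + 2 ≤ c j ∧ c j + (b : ℤ) + 2 ≤ (L : ℤ) + 1)
    {W : LGConfig 4 G → ℝ} (hWc : Continuous W) {MW : ℝ} (hMW : ∀ U, |W U| ≤ MW)
    {SW : Finset (Literature.MathematicalPhysics.QuantumLattice.ZdEdge 4)} (hWS : IsCylinder W SW)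
    (hSW : ∀ e ∈ SW, ∀ j, c j ≤ e.1 j ∧ e.1 j ≤ c j + b)
    (S : Finset ((Fin 4 × Fin 4) × (Fin 4 → ℤ))) (hS : ∀ pl ∈ S, ∀ j : Fin 4, c j - 1 ≤ pl.2 j ∧ pl.2 j ≤ c j + b)
    (g₀ : ℝ) (g : (Fin 4 × Fin 4) × (Fin 4 → ℤ) → ℝ) {p ε : ℝ} (hε : 0 < ε)
    (hRBL : ∀ ζ, |kerE G r β c b ζ W - p + (g₀ + ∑ pl ∈ S, g pl * plane G r pl.1 pl.2 ζ)| ≤ Real.sqrt ε / 2)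
    (hSF : 4 * ε ≤ ∑ pl ∈ S, ∑ pl' ∈ S, g pl * g pl' *
        (torusE G r β L (fun V => plane G r pl.1 pl.2 (cfgReflect V) * plane G r pl'.1 pl'.2 V) -
          torusE G r β L (fun V => plane G r pl.1 pl.2 (cfgReflect V)) * torusE G r β L (plane G r pl'.1 pl'.2))) :
    9 * ε / 4 ≤ torusE G r β L (fun V => W (cfgReflect V) * W V) -
      torusE G r β L (fun V => W (cfgReflect V)) * torusE G r β L W := by
  obtain ⟨M𝒢, hM𝒢⟩ := exists_abs_affinePlane_le G r S g₀ g
  rw [← shellCov_affine_eq_sum G r β L S g₀ g] at hSF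
  exact mirrorCov_ge_of_boundaryResponse G r hβ c b L hc0 hcL hc hWc hMW hWS hSW (continuous_affinePlane G r S g₀ g)
    hM𝒢 (isCylinder_affinePlane G r S g₀ g) (affinePlane_window hS) hε hRBL hSF

/-- **The bare mirror floor from an affine response law, measure-typical form (fixed `β ≥ 0`, torus `2L+1`).**
Same geometry and data;
(RBL-aff-L²) `∫ (kerE_Q^{lift U}(W) − p + (g₀ + ∑_b g_b plane_b(lift U)))² dμ_T(U) ≤ ε/4` on THIS torus;
(SF-aff)     `4ε ≤ ∑_{b,b'} g_b g_{b'} Cov_T(plane_b∘Θ₀, plane_{b'})`.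
Then `9ε/4 ≤ Cov_T(W∘Θ₀, W)` (`mirrorCov_ge_of_boundaryResponse_l2` at the affine pin). [folklore] -/
theorem mirrorCov_ge_of_affineResponse_l2 {β : ℝ} (hβ : 0 ≤ β) (c : Fin 4 → ℤ) (b L : ℕ) (hc0 : 1 ≤ c 0)
    (hcL : c 0 + (b : ℤ) + 3 ≤ L) (hc : ∀ j, -(L : ℤ) + 2 ≤ c j ∧ c j + (b : ℤ) + 2 ≤ (L : ℤ) + 1)
    {W : LGConfig 4 G → ℝ} (hWc : Continuous W) {MW : ℝ} (hMW : ∀ U, |W U| ≤ MW)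
    {SW : Finset (Literature.MathematicalPhysics.QuantumLattice.ZdEdge 4)} (hWS : IsCylinder W SW)
    (hSW : ∀ e ∈ SW, ∀ j, c j ≤ e.1 j ∧ e.1 j ≤ c j + b)
    (S : Finset ((Fin 4 × Fin 4) × (Fin 4 → ℤ))) (hS : ∀ pl ∈ S, ∀ j : Fin 4, c j - 1 ≤ pl.2 j ∧ pl.2 j ≤ c j + b)
    (g₀ : ℝ) (g : (Fin 4 × Fin 4) × (Fin 4 → ℤ) → ℝ) {p ε : ℝ} (hε : 0 < ε)
    (hRBL2 : torusE G r β L (fun V =>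
        (kerE G r β c b V W - p + (g₀ + ∑ pl ∈ S, g pl * plane G r pl.1 pl.2 V)) ^ 2) ≤ ε / 4)
    (hSF : 4 * ε ≤ ∑ pl ∈ S, ∑ pl' ∈ S, g pl * g pl' *
        (torusE G r β L (fun V => plane G r pl.1 pl.2 (cfgReflect V) * plane G r pl'.1 pl'.2 V) -
          torusE G r β L (fun V => plane G r pl.1 pl.2 (cfgReflect V)) * torusE G r β L (plane G r pl'.1 pl'.2))) :
    9 * ε / 4 ≤ torusE G r β L (fun V => W (cfgReflect V) * W V) -
      torusE G r β L (fun V => W (cfgReflect V)) * torusE G r β L W := by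
  obtain ⟨M𝒢, hM𝒢⟩ := exists_abs_affinePlane_le G r S g₀ g
  rw [← shellCov_affine_eq_sum G r β L S g₀ g] at hSF
  exact mirrorCov_ge_of_boundaryResponse_l2 G r hβ c b L hc0 hcL hc hWc hMW hWS hSW (continuous_affinePlane G r S g₀ g)
    hM𝒢 (isCylinder_affinePlane G r S g₀ g) (affinePlane_window hS) hε hRBL2 hSF

end AffineFloor

end Summit.QuantumFields.YangMills.Cruxes.NT.MarkovMirror

end
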